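/-
Copyright (c) 2026 the pub-hodgecm-mathlib formalisation cell (harness21).  Prover seat hodgecm-mathlib-LH4-p15 (g2), req620 Track A «(D-RAM) FOUR-FRAME» squad
(STAGE-1b, row (2) of the piece `f_{T₊}`, the (β₂) road (R-36) «PURE-CELL LEDGER»; β₂ sub-dealer LH4-p04 (g10) WORD #24 ‹TERM.letter.v2› 78b8538f5e7a241e, holder LH4-p15 (g2):
(T-b5a) «THE FLIPS OF A ROW CELL IN LANE B»), 2026-09-05.
-/
import Summits.HodgeConjecture.HodgeConjecture.Theorems.F0P3cDyRamToricCensusDefs    -- ★ DEFS (LH4): `dualGen` and the valued-field preamble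
import Mathlib.FieldTheory.Finite.Basic
import HarnessLib

/-!
# Crux `H413`, line LH4 «(D-RAM) FOUR-FRAME» — STAGE-1b, row (2), the (β₂) road (R-36), (ROW-TERM): «THE FLIPS OF A ROW CELL IN LANE B» — the transport multipliers
# `ρκ₂ ∕ ρκ₁` between (a) two VERTEX digits and (b) two NEAR points of the cell's sphere are `Θ`-norms, from the type-RamK token `hFN` and the norm-depth law on `M` alone
# (no lane-C letters `_c13 ∕ _c20`): the realisability input of LH4-p16 (g2)'s ★ `ncard_fibre_eq_ncard_fibre_of_sphere` for LH4-p19 (g2)'s socket letter (hF), lane B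

Cell `hodgecm-mathlib` (D-0151), FLOOR 0, crux item H413 = `stmt-HodgeConjecture-24833`, route of record `HCCMUnconditional`; squad F0∕P3c∕LH4; lane
`--supports stmt-HodgeConjecture-24833 --as helper` (count-neutral; pays NO tier-0 row).  THEOREMS ONLY (no `def`, no instance, no notation, no `sorry`, default heartbeats);
★-only imports; states NO law; (β₂) stays a HYPOTHESIS.  DATUM-FREE one-field letters: `K` (the eigen-field `M` of the block) with two commuting ring endomorphisms `ρ`, `Θ`
(`ρ² = 1`, isometric), a `ρ`-fixed uniformiser `ϖM` (`|ϖM| = exp(−1)`), `Θ`-fixed non-zero elements of valuation in `exp(2ℤ)` (the clause of `IsRamifiedQuadraticDatum Θ ϖM d t`), and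
the two NORM SUPPLIERS of lane B: `hFN : ∀ f, ρf = f → Θf = f → |f| = 1 → ∃ z, zΘz = f` (★ `forall_fixed_fixed_exists_mul_theta_eq_of_frame`) and `hN4 : ∀ u, Θu = u → |u − 1| ≤ |ϖM|^4 →
∃ z, zΘz = u` (★ Lit `exists_mul_map_eq_of_fixed_of_v_sub_one_le_pred` on the `Θ`-datum at `2d = 4`).
WHY (this seat's (ROW-TERM) plan for ‹TERM.v2›, NOTES 01:25Z).  LH4-p19's socket ★ p863833 wants (hF) «fibres over two LITERAL digits are equinumerous»; LH4-p16's ★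
`ncard_fibre_eq_ncard_fibre_of_sphere` delivers it GIVEN a multiplier `ε` with `εΘε = ρκ₂∕ρκ₁`; in lane C that `ε` comes from ★ p863223's class test (`_c13`, `_c20`), letters the
lane-B block ‹TERM› does not carry.  THIS FILE supplies `ε` in lane B for the two moves the terminal-cell instance needs, with `LIT y :≡` «on the sphere and realisable from a vertex»:
(a) between two VERTEX digits `κ̂ = ρu₀∕t`, `κ̂′` (`u₀ = h·x₀Θx₀`, `t = Tr_ρ u₀`): `ρκ̂′∕ρκ̂ = N_Θ(x₀′∕x₀)·(t∕t′)` and `t∕t′` is a doubly-fixed unit (`hFN`); (b) between two sphere points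
`κᵢ = κ₀ + Wᵢξ₀` with doubly-fixed coordinates `|W₂ − W₁| ≤ |ϖM|²` (`|κ₁| = |ξ₀| > 1`): `ρκ₂∕ρκ₁ = 1 − w`, `w = (W₂ − W₁)ξ₀∕ρκ₁`, `|w| ≤ |ϖM|²`, `|w − ρw| = |W₂ − W₁|∕|ξ₀| < |ϖM|²`, so
`s = w∕(ϖM·ΘϖM)` has `|s − ρs| < 1` and — THE RESIDUE LIFT (§2): `s₀ := N_ρ(s^{q²∕2})` is doubly fixed with `|s − s₀| < 1` (Frobenius `s^{q²} ≡ s`, `q² = #𝓀[M]` even) — `w ≡ w₀`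
doubly fixed to `< |ϖM|²`, i.e. `≤ |ϖM|⁴` (parity); then `1 − w = (1 − w₀)·u` with `1 − w₀` a doubly-fixed unit (`hFN`) and `|u − 1| ≤ |ϖM|⁴` (`hN4`).  (Behind (b): `χ_{M∕K}` is
`ρ`-invariant, hence trivial on `k_F ⊂ k_K`; the lift makes this valuation-theoretic.)
* §1 `inv_cellScalar_mul_inv_trace_eq` — LH4-p16's vertex coordinate IS the generator digit: `D₀⁻¹·(Tr_ρ D₀⁻¹)⁻¹ = ρu₀ ∕ Tr_ρ u₀`.
* §2 `v_pow_sub_pow_le`, `v_pow_card_sub_lt`, `exists_card_residueField_eq_two_mul`, `exists_fixed_fixed_sub_lt_of_map_sub_lt` (the residue lift).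
* §3 `exists_mul_theta_eq_hatKappa_flip` (a).  §4 HEAD `exists_mul_theta_eq_sphere_flip_of_near` (b).
WHAT IS NOT CLAIMED: (hF) itself, any fibre count, the class test of ★ p863223, any census identity.
HONEST LABEL.  Count-neutral valuation algebra; nothing printed is asserted; no census law is stated; ‹TERM.v2› stays OPEN; `HC_CM` is proved only modulo the 7 printed citations
(2 remaining named inputs: hLiu418 = `stmt-HodgeConjecture-24832`, h413 = `stmt-HodgeConjecture-24833`) until rung 0 closes.
## References
* [Serre1979] J.-P. Serre, *Local Fields*, GTM 67 (1979): Ch. I §7 Prop. 21 (Teichmüller-type lifts), Ch. V §2 Prop. 3, §3 Cor. 3 pp. 84–86 (norm groups and their depth), Ch. XIV §6.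
* [Kottwitz1986BaseChangeUnits] R. E. Kottwitz, *Base change for unit elements of Hecke algebras*, Compositio Math. 60 (1986): §1 pp. 240–241.
* [Jacobowitz1962] R. Jacobowitz, *Hermitian forms over local fields*, Amer. J. Math. 84 (1962): §4 (the glue unit `Tr_ρ D₀⁻¹`).
-/

set_option autoImplicit false

noncomputable section

namespace Summit.HodgeConjecture.HodgeConjecture.Cruxes.H413.F0P3cDyRamTerminalCellDigitFlip

open scoped Valued WithZero
open WithZero
open Summit.HodgeConjecture.HodgeConjecture.Cruxes.H413.F0P3cDyRamToricCensusDefs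

variable {K : Type} [Field K] [Valued K ℤᵐ⁰] {ρ Θ : K →+* K} {α : K}

/-! ## §1 LH4-p16's vertex coordinate is the generator digit -/

omit [Valued K ℤᵐ⁰] in
/-- **`D₀⁻¹·(jE pw)⁻¹ = ρu₀ ∕ Tr_ρ u₀`**: with `D₀ = cc(α − ρα)·Θ(dualGen ρ Θ α cc h x₀)`, `u₀ = h·x₀Θx₀` (`Θh = h`, `Θ² = 1`, `Θρ = ρΘ`, `ρ² = 1`, `ρcc = cc`) and the glue letter
`D₀⁻¹ + ρD₀⁻¹ = P` (LH4-p16's `jE pw`), if `cc(α − ρα) ≠ 0`, `x₀ ≠ 0`, `h ≠ 0` and `Tr_ρ u₀ ≠ 0` then `D₀⁻¹·P⁻¹ = ρu₀ ∕ (u₀ + ρu₀)` — the point `κ̂` of ★ p863914's `Vf`.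
[cite: Jacobowitz1962, §4] -/
theorem inv_cellScalar_mul_inv_trace_eq (hρρ : ∀ x, ρ (ρ x) = x) (hΘΘ : ∀ x, Θ (Θ x) = x) (hΘρ : ∀ x, Θ (ρ x) = ρ (Θ x))
    {cc h x₀ : K} (hc : ρ cc = cc) (hΘh : Θ h = h) (hcc : cc * (α - ρ α) ≠ 0) (hx₀ : x₀ ≠ 0) (hh : h ≠ 0)
    (ht : h * (x₀ * Θ x₀) + ρ (h * (x₀ * Θ x₀)) ≠ 0) {P : K}
    (hTr : (cc * (α - ρ α) * Θ (dualGen ρ Θ α cc h x₀))⁻¹ + ρ (cc * (α - ρ α) * Θ (dualGen ρ Θ α cc h x₀))⁻¹ = P) :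
    (cc * (α - ρ α) * Θ (dualGen ρ Θ α cc h x₀))⁻¹ * P⁻¹ = ρ (h * (x₀ * Θ x₀)) / (h * (x₀ * Θ x₀) + ρ (h * (x₀ * Θ x₀))) := by
  set u₀ : K := h * (x₀ * Θ x₀) with hu₀
  set ν : K := cc * (α - ρ α) * Θ (cc * (α - ρ α)) with hν
  have hD₀ : cc * (α - ρ α) * Θ (dualGen ρ Θ α cc h x₀) = u₀ * ν := by
    rw [dualGen_def, hu₀, hν]; simp only [map_mul, hΘh, hΘΘ]; ring
  have hρν : ρ ν = ν := by
    rw [hν]; simp only [map_mul, map_sub, hc, hρρ, ← hΘρ]; ring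
  have hu0 : u₀ ≠ 0 := mul_ne_zero hh (mul_ne_zero hx₀ ((map_ne_zero Θ).2 hx₀))
  have hρu0 : ρ u₀ ≠ 0 := (map_ne_zero ρ).2 hu0
  have hν0 : ν ≠ 0 := mul_ne_zero hcc ((map_ne_zero Θ).2 hcc)
  have hP : P = (u₀ + ρ u₀) / (u₀ * ρ u₀ * ν) := by
    rw [← hTr, hD₀, map_inv₀, map_mul, hρν]; field_simp; ring
  rw [hD₀, hP]
  field_simp

/-! ## §2 The residue lift: a `Θ`-fixed integer with `ρ`-fixed residue is a doubly-fixed element to first order -/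

/-- `|aⁿ − bⁿ| ≤ |a − b|` for integers `a, b`. [cite: Serre1979, Ch. I §7 Prop. 21] -/
theorem v_pow_sub_pow_le {a b : K} (ha : Valued.v a ≤ 1) (hb : Valued.v b ≤ 1) (n : ℕ) : Valued.v (a ^ n - b ^ n) ≤ Valued.v (a - b) := by
  induction n with
  | zero => simp
  | succ n ih =>
    have e : a ^ (n + 1) - b ^ (n + 1) = a * (a ^ n - b ^ n) + (a - b) * b ^ n := by ring
    rw [e]
    refine (Valuation.map_add _ _ _).trans (max_le ?_ ?_)
    · rw [Valuation.map_mul]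
      calc Valued.v a * Valued.v (a ^ n - b ^ n) ≤ 1 * Valued.v (a - b) := mul_le_mul' ha ih
        _ = Valued.v (a - b) := one_mul _
    · rw [Valuation.map_mul, Valuation.map_pow]
      calc Valued.v (a - b) * Valued.v b ^ n ≤ Valued.v (a - b) * 1 := mul_le_mul' le_rfl (pow_le_one₀ zero_le hb)
        _ = Valued.v (a - b) := mul_one _

/-- **FROBENIUS**: for an integer `s`, `|s^{#𝓀} − s| < 1` (`a^{#𝓀} = a` in the residue field). [cite: Serre1979, Ch. I §7 Prop. 21] -/
theorem v_pow_card_sub_lt [Finite 𝓀[K]] {s : K} (hs : Valued.v s ≤ 1) : Valued.v (s ^ Nat.card 𝓀[K] - s) < 1 := by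
  haveI : Fintype 𝓀[K] := Fintype.ofFinite _
  set S : 𝒪[K] := ⟨s, hs⟩ with hS
  have hres : IsLocalRing.residue 𝒪[K] (S ^ Nat.card 𝓀[K] - S) = 0 := by
    rw [map_sub, map_pow, Nat.card_eq_fintype_card, FiniteField.pow_card, sub_self]
  rw [IsLocalRing.residue_eq_zero_iff, IsLocalRing.mem_maximalIdeal, mem_nonunits_iff, Valuation.Integer.not_isUnit_iff_valuation_lt_one] at hres
  simpa [hS] using hres

/-- **`#𝓀` IS EVEN** when `|2| < 1` (residue characteristic `2`). [cite: Serre1979, Ch. I §7] -/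
theorem exists_card_residueField_eq_two_mul [Finite 𝓀[K]] (h2 : Valued.v (2 : K) < 1) : ∃ n : ℕ, Nat.card 𝓀[K] = 2 * n := by
  haveI : Fintype 𝓀[K] := Fintype.ofFinite _
  have h20 : ((2 : ℕ) : 𝓀[K]) = 0 := by
    have h2O : (2 : 𝒪[K]) ∈ IsLocalRing.maximalIdeal 𝒪[K] := by
      rw [IsLocalRing.mem_maximalIdeal, mem_nonunits_iff]
      exact Valuation.Integer.not_isUnit_iff_valuation_lt_one.2 (by exact_mod_cast h2)
    have h := (IsLocalRing.residue_eq_zero_iff (2 : 𝒪[K])).2 h2O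
    rw [map_ofNat] at h
    exact_mod_cast h
  haveI : CharP 𝓀[K] 2 := (CharP.charP_iff_prime_eq_zero Nat.prime_two).2 h20
  obtain ⟨n, -, hn⟩ := FiniteField.card 𝓀[K] 2
  obtain ⟨k, hk⟩ : ∃ k : ℕ, (n : ℕ) = k + 1 := ⟨(n : ℕ) - 1, by have := n.pos; omega⟩
  refine ⟨2 ^ k, ?_⟩
  rw [Nat.card_eq_fintype_card, hn, hk, pow_succ']

/-- **THE RESIDUE LIFT.**  `ρ, Θ` commuting ring endomorphisms with `ρ² = 1`, `ρ` isometric, `|2| < 1`, finite residue field: a `Θ`-fixed integer `s` with `|s − ρs| < 1` is a DOUBLY-FIXED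
element to first order — `∃ s₀, ρs₀ = s₀ ∧ Θs₀ = s₀ ∧ |s − s₀| < 1` (`s₀ := N_ρ(s^{#𝓀∕2})`: `N_ρ(v) ≡ v² = s^{#𝓀} ≡ s`).  [cite: Serre1979, Ch. I §7 Prop. 21; Ch. V §2 Prop. 3] -/
theorem exists_fixed_fixed_sub_lt_of_map_sub_lt [Finite 𝓀[K]] (hρρ : ∀ x, ρ (ρ x) = x) (hvρ : ∀ x, Valued.v (ρ x) = Valued.v x)
    (hΘρ : ∀ x, Θ (ρ x) = ρ (Θ x)) (h2 : Valued.v (2 : K) < 1)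
    {s : K} (hΘs : Θ s = s) (hs : Valued.v s ≤ 1) (hsρ : Valued.v (s - ρ s) < 1) :
    ∃ s₀ : K, ρ s₀ = s₀ ∧ Θ s₀ = s₀ ∧ Valued.v (s - s₀) < 1 := by
  obtain ⟨n, hn⟩ := exists_card_residueField_eq_two_mul (K := K) h2
  set v : K := s ^ n with hv
  refine ⟨v * ρ v, by rw [map_mul, hρρ, mul_comm], by rw [map_mul, hΘρ, hv, map_pow, hΘs], ?_⟩
  have hv1 : Valued.v v ≤ 1 := by rw [hv, Valuation.map_pow]; exact pow_le_one₀ zero_le hs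
  have hρs1 : Valued.v (ρ s) ≤ 1 := by rw [hvρ]; exact hs
  -- `s − vρv = (s − s^{#𝓀}) + v(v − ρv)`
  have e : s - v * ρ v = (s - s ^ Nat.card 𝓀[K]) + v * (v - ρ v) := by rw [hn, pow_mul', ← hv]; ring
  rw [e]
  refine lt_of_le_of_lt (Valuation.map_add _ _ _) (max_lt ?_ ?_)
  · rw [Valuation.map_sub_swap]; exact v_pow_card_sub_lt hs
  · rw [Valuation.map_mul]
    calc Valued.v v * Valued.v (v - ρ v) ≤ 1 * Valued.v (v - ρ v) := mul_le_mul' hv1 le_rfl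
      _ = Valued.v (s ^ n - (ρ s) ^ n) := by rw [one_mul, hv, map_pow]
      _ ≤ Valued.v (s - ρ s) := v_pow_sub_pow_le hs hρs1 n
      _ < 1 := hsρ

/-! ## §3 (a) The flip between two vertex digits -/

omit [Valued K ℤᵐ⁰] in
/-- **`ρκ̂ = u₀ ∕ t`** for `κ̂ = ρu₀ ∕ t`, `t = Tr_ρ u₀` (`ρ² = 1`). [cite: Jacobowitz1962, §4] -/
theorem map_hatKappa_eq (hρρ : ∀ x, ρ (ρ x) = x) (u₀ : K) :
    ρ (ρ u₀ / (u₀ + ρ u₀)) = u₀ / (u₀ + ρ u₀) := by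
  rw [map_div₀, hρρ, map_add, hρρ, add_comm (ρ u₀) u₀]

/-- **(a) «THE FLIP BETWEEN TWO VERTEX DIGITS IS A `Θ`-NORM».**  `u₀ = h·x₀Θx₀`, `u₀′ = h·x₀′Θx₀′`, `t = Tr_ρ u₀`, `t′ = Tr_ρ u₀′` doubly-fixed UNITS (★ `trace_letters`), `x₀ ≠ 0`, `h ≠ 0`, `ρ² = 1`:
`ρκ̂′ ∕ ρκ̂ = N_Θ(x₀′∕x₀)·(t∕t′) = zΘz` with `z := (x₀′∕x₀)·z₁`, `z₁Θz₁ = t∕t′` (`hFN`). [cite: Serre1979, Ch. V §2 Prop. 3] [cite: Kottwitz1986BaseChangeUnits, §1 pp. 240–241] -/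
theorem exists_mul_theta_eq_hatKappa_flip (hρρ : ∀ x, ρ (ρ x) = x)
    (hFN : ∀ f : K, ρ f = f → Θ f = f → Valued.v f = 1 → ∃ z : K, z * Θ z = f)
    {h x₀ x₀' : K} (hh : h ≠ 0) (hx₀ : x₀ ≠ 0)
    (hρt : ρ (h * (x₀ * Θ x₀) + ρ (h * (x₀ * Θ x₀))) = h * (x₀ * Θ x₀) + ρ (h * (x₀ * Θ x₀)))
    (hΘt : Θ (h * (x₀ * Θ x₀) + ρ (h * (x₀ * Θ x₀))) = h * (x₀ * Θ x₀) + ρ (h * (x₀ * Θ x₀)))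
    (ht1 : Valued.v (h * (x₀ * Θ x₀) + ρ (h * (x₀ * Θ x₀))) = 1)
    (hρt' : ρ (h * (x₀' * Θ x₀') + ρ (h * (x₀' * Θ x₀'))) = h * (x₀' * Θ x₀') + ρ (h * (x₀' * Θ x₀')))
    (hΘt' : Θ (h * (x₀' * Θ x₀') + ρ (h * (x₀' * Θ x₀'))) = h * (x₀' * Θ x₀') + ρ (h * (x₀' * Θ x₀')))
    (ht'1 : Valued.v (h * (x₀' * Θ x₀') + ρ (h * (x₀' * Θ x₀'))) = 1) :
    ∃ z : K, z * Θ z = ρ (ρ (h * (x₀' * Θ x₀')) / (h * (x₀' * Θ x₀') + ρ (h * (x₀' * Θ x₀')))) /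
      ρ (ρ (h * (x₀ * Θ x₀)) / (h * (x₀ * Θ x₀) + ρ (h * (x₀ * Θ x₀)))) := by
  rw [map_hatKappa_eq hρρ, map_hatKappa_eq hρρ]
  set t : K := h * (x₀ * Θ x₀) + ρ (h * (x₀ * Θ x₀)) with htdef
  set t' : K := h * (x₀' * Θ x₀') + ρ (h * (x₀' * Θ x₀')) with ht'def
  have ht0 : t ≠ 0 := fun h0 => by rw [h0, map_zero] at ht1; exact zero_ne_one ht1
  have ht'0 : t' ≠ 0 := fun h0 => by rw [h0, map_zero] at ht'1; exact zero_ne_one ht'1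
  -- `t ∕ t′` is a doubly-fixed unit, hence a `Θ`-norm
  obtain ⟨z₁, hz₁⟩ := hFN (t / t') (by rw [map_div₀, hρt, hρt']) (by rw [map_div₀, hΘt, hΘt'])
    (by rw [map_div₀, ht1, ht'1, div_one])
  refine ⟨x₀' / x₀ * z₁, ?_⟩
  have hΘx₀ : Θ x₀ ≠ 0 := (map_ne_zero Θ).2 hx₀
  have e : x₀' / x₀ * z₁ * Θ (x₀' / x₀ * z₁) = (x₀' * Θ x₀') / (x₀ * Θ x₀) * (z₁ * Θ z₁) := by
    rw [map_mul, map_div₀]; field_simp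
  rw [e, hz₁]
  clear_value t t'
  field_simp

/-! ## §4 (b) HEAD — the flip between two near points of the sphere -/

/-- **(b) HEAD — «THE FLIP BETWEEN TWO NEAR SPHERE DIGITS IS A `Θ`-NORM IN LANE B».**  Letters as in the module docstring; `κ₀, ξ₀ ∈ Fix Θ` with `Tr_ρ κ₀ = 1`, `ρξ₀ = −ξ₀`,
`|ξ₀| > 1`; two doubly-fixed coordinates `W₁, W₂` with `|W₂ − W₁| ≤ |ϖM|²`; the point `κ₁ = κ₀ + W₁ξ₀` ON THE SPHERE `|κ₁| = |ξ₀|`.  THEN `∃ z, zΘz = ρ(κ₀ + W₂ξ₀) ∕ ρ(κ₀ + W₁ξ₀)`.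
[cite: Serre1979, Ch. I §7 Prop. 21; Ch. V §2 Prop. 3; Ch. V §3 Cor. 3 pp. 84–86] [cite: Kottwitz1986BaseChangeUnits, §1 pp. 240–241] -/
theorem exists_mul_theta_eq_sphere_flip_of_near [Finite 𝓀[K]] (hρρ : ∀ x, ρ (ρ x) = x) (hvρ : ∀ x, Valued.v (ρ x) = Valued.v x)
    (hΘΘ : ∀ x, Θ (Θ x) = x) (hΘρ : ∀ x, Θ (ρ x) = ρ (Θ x)) (hvΘ : ∀ x, Valued.v (Θ x) = Valued.v x) (h2 : Valued.v (2 : K) < 1)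
    {ϖM : K} (hϖM : Valued.v ϖM = exp (-1 : ℤ)) (hρϖ : ρ ϖM = ϖM)
    (hfixΘ : ∀ x : K, Θ x = x → x ≠ 0 → ∃ n : ℤ, Valued.v x = exp (2 * n))
    (hFN : ∀ f : K, ρ f = f → Θ f = f → Valued.v f = 1 → ∃ z : K, z * Θ z = f)
    (hN4 : ∀ u : K, Θ u = u → Valued.v (u - 1) ≤ Valued.v ϖM ^ 4 → ∃ z : K, z * Θ z = u)
    {κ₀ ξ₀ W₁ W₂ : K} (hκ₀ : κ₀ + ρ κ₀ = 1) (hΘκ₀ : Θ κ₀ = κ₀) (hξ : ρ ξ₀ = -ξ₀) (hΘξ : Θ ξ₀ = ξ₀) (hξ1 : 1 < Valued.v ξ₀)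
    (hW₁ : ρ W₁ = W₁) (hΘW₁ : Θ W₁ = W₁) (hW₂ : ρ W₂ = W₂) (hΘW₂ : Θ W₂ = W₂)
    (hsph : Valued.v (κ₀ + W₁ * ξ₀) = Valued.v ξ₀) (hnear : Valued.v (W₂ - W₁) ≤ Valued.v ϖM ^ 2) :
    ∃ z : K, z * Θ z = ρ (κ₀ + W₂ * ξ₀) / ρ (κ₀ + W₁ * ξ₀) := by
  have hvϖ0 : Valued.v ϖM ≠ 0 := by rw [hϖM]; exact exp_ne_zero
  have hϖ0 : ϖM ≠ 0 := fun h0 => by rw [h0, map_zero] at hvϖ0; exact hvϖ0 rfl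
  have hξpos : (0 : ℤᵐ⁰) < Valued.v ξ₀ := lt_trans zero_lt_one hξ1
  have hξ0 : ξ₀ ≠ 0 := fun h0 => by rw [h0, map_zero] at hξpos; exact lt_irrefl _ hξpos
  obtain ⟨κ₁, hκ₁⟩ : ∃ κ₁ : K, κ₁ = κ₀ + W₁ * ξ₀ := ⟨_, rfl⟩
  rw [← hκ₁] at hsph ⊢
  have hκ₁tr : κ₁ + ρ κ₁ = 1 := by rw [hκ₁, map_add, map_mul, hW₁, hξ]; linear_combination hκ₀
  have hκ₁0 : κ₁ ≠ 0 := fun h0 => by rw [h0, map_zero] at hsph; exact hξ0 ((Valuation.zero_iff _).1 hsph.symm)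
  have hρκ₁0 : ρ κ₁ ≠ 0 := (map_ne_zero ρ).2 hκ₁0
  have hρκ₁v : Valued.v (ρ κ₁) = Valued.v ξ₀ := by rw [hvρ, hsph]
  -- `ρκ₂ = ρκ₁ − ΔW·ξ₀`, so `ρκ₂ ∕ ρκ₁ = 1 − w`, `w = ΔW·ξ₀ ∕ ρκ₁`
  obtain ⟨w, hw⟩ : ∃ w : K, w = (W₂ - W₁) * ξ₀ / ρ κ₁ := ⟨_, rfl⟩
  have hT : ρ (κ₀ + W₂ * ξ₀) / ρ κ₁ = 1 - w := by
    have e : ρ (κ₀ + W₂ * ξ₀) = ρ κ₁ - (W₂ - W₁) * ξ₀ := by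
      rw [hκ₁, map_add, map_add, map_mul, map_mul, hW₁, hW₂, hξ]; ring
    rw [e, sub_div, div_self hρκ₁0, hw]
  rw [hT]
  -- letters of `w`: `Θw = w`, `|w| ≤ |ϖM|²`, `|w − ρw| < |ϖM|²`
  have hΘκ₁ : Θ κ₁ = κ₁ := by rw [hκ₁, map_add, map_mul, hΘκ₀, hΘW₁, hΘξ]
  have hΘw : Θ w = w := by rw [hw, map_div₀, map_mul, map_sub, hΘW₂, hΘW₁, hΘξ, hΘρ, hΘκ₁]
  have hwv : Valued.v w ≤ Valued.v ϖM ^ 2 := by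
    rw [hw, map_div₀, Valuation.map_mul, hρκ₁v, mul_div_assoc, div_self (ne_of_gt hξpos), mul_one]; exact hnear
  have hwρ : Valued.v (w - ρ w) < Valued.v ϖM ^ 2 := by
    have e : w - ρ w = (W₂ - W₁) * ξ₀ / (κ₁ * ρ κ₁) := by
      rw [hw, map_div₀, map_mul, map_sub, hW₂, hW₁, hξ, hρρ, div_sub_div _ _ hρκ₁0 hκ₁0, mul_comm (ρ κ₁) κ₁]
      congr 1
      linear_combination (W₂ - W₁) * ξ₀ * hκ₁tr
    rw [e, map_div₀, Valuation.map_mul, Valuation.map_mul, hρκ₁v, hsph, mul_div_assoc, div_mul_cancel_left₀ (ne_of_gt hξpos)]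
    have hinv : (Valued.v ξ₀)⁻¹ < 1 := inv_lt_one_of_one_lt₀ hξ1
    calc Valued.v (W₂ - W₁) * (Valued.v ξ₀)⁻¹ ≤ Valued.v ϖM ^ 2 * (Valued.v ξ₀)⁻¹ := mul_le_mul' hnear le_rfl
      _ < Valued.v ϖM ^ 2 * 1 := mul_lt_mul_of_pos_left hinv (pow_pos (zero_lt_iff.2 hvϖ0) _)
      _ = Valued.v ϖM ^ 2 := mul_one _
  -- the scale `c = ϖM·ΘϖM` (doubly fixed, `|c| = |ϖM|²`) and `s = w ∕ c`
  set c : K := ϖM * Θ ϖM with hc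
  have hΘc : Θ c = c := by rw [hc, map_mul, hΘΘ, mul_comm]
  have hρc : ρ c = c := by rw [hc, map_mul, hρϖ, ← hΘρ, hρϖ]
  have hcv : Valued.v c = Valued.v ϖM ^ 2 := by rw [hc, Valuation.map_mul, hvΘ, pow_two]
  have hcpos : (0 : ℤᵐ⁰) < Valued.v c := by rw [hcv]; exact pow_pos (zero_lt_iff.2 hvϖ0) _
  have hc0 : c ≠ 0 := fun h0 => by rw [h0, map_zero] at hcpos; exact lt_irrefl _ hcpos
  set s : K := w / c with hs
  have hΘs : Θ s = s := by rw [hs, map_div₀, hΘw, hΘc]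
  have hs1 : Valued.v s ≤ 1 := by rw [hs, map_div₀, div_le_one₀ hcpos, hcv]; exact hwv
  have hsρ : Valued.v (s - ρ s) < 1 := by
    rw [hs, map_div₀, hρc, ← sub_div, map_div₀, div_lt_one₀ hcpos, hcv]; exact hwρ
  obtain ⟨s₀, hρs₀, hΘs₀, hss₀⟩ := exists_fixed_fixed_sub_lt_of_map_sub_lt hρρ hvρ hΘρ h2 hΘs hs1 hsρ
  -- `w₀ := c·s₀` is doubly fixed with `|w − w₀| < |ϖM|²`, hence `≤ |ϖM|⁴` (parity of `Θ`-fixed valuations)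
  set w₀ : K := c * s₀ with hw₀
  have hww₀ : w - w₀ = c * (s - s₀) := by rw [hw₀, hs, mul_sub, mul_div_cancel₀ _ hc0]
  have hΘd : Θ (w - w₀) = w - w₀ := by rw [map_sub, hΘw, hw₀, map_mul, hΘc, hΘs₀]
  have hdlt : Valued.v (w - w₀) < Valued.v ϖM ^ 2 := by
    rw [hww₀, Valuation.map_mul, hcv]
    calc Valued.v ϖM ^ 2 * Valued.v (s - s₀) < Valued.v ϖM ^ 2 * 1 := mul_lt_mul_of_pos_left hss₀ (pow_pos (zero_lt_iff.2 hvϖ0) _)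
      _ = Valued.v ϖM ^ 2 := mul_one _
  have hd4 : Valued.v (w - w₀) ≤ Valued.v ϖM ^ 4 := by
    by_cases hd0 : w - w₀ = 0
    · rw [hd0, map_zero]; exact zero_le
    obtain ⟨n, hn⟩ := hfixΘ (w - w₀) hΘd hd0
    rw [hn, hϖM, ← exp_nsmul, nsmul_eq_mul, exp_lt_exp] at hdlt
    rw [hn, hϖM, ← exp_nsmul, nsmul_eq_mul, exp_le_exp]
    push_cast at hdlt ⊢
    omega
  -- `1 − w₀` is a doubly-fixed unit (a `Θ`-norm by `hFN`); `(1 − w) ∕ (1 − w₀) ≡ 1 (ϖM⁴)` (a `Θ`-norm by `hN4`)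
  have hϖ2lt : Valued.v ϖM ^ 2 < 1 := by
    rw [hϖM, ← exp_nsmul, nsmul_eq_mul, ← exp_zero, exp_lt_exp]; norm_num
  have hw₀v : Valued.v w₀ < 1 := by
    have e : w₀ = w - (w - w₀) := by ring
    rw [e]
    exact lt_of_le_of_lt (Valuation.map_sub _ _ _) (max_lt (lt_of_le_of_lt hwv hϖ2lt) (hdlt.trans hϖ2lt))
  have h1w₀ : Valued.v (1 - w₀) = 1 := by
    rw [Valuation.map_one_sub_of_lt]
    exact hw₀v
  have h1w₀0 : 1 - w₀ ≠ 0 := fun h0 => by rw [h0, map_zero] at h1w₀; exact zero_ne_one h1w₀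
  obtain ⟨z₀, hz₀⟩ := hFN (1 - w₀) (by rw [map_sub, map_one, hw₀, map_mul, hρc, hρs₀]) (by rw [map_sub, map_one, hw₀, map_mul, hΘc, hΘs₀]) h1w₀
  obtain ⟨z₁, hz₁⟩ := hN4 ((1 - w) / (1 - w₀)) (by rw [map_div₀, map_sub, map_one, hΘw, map_sub, map_one, hw₀, map_mul, hΘc, hΘs₀]) (by
    have e : (1 - w) / (1 - w₀) - 1 = -(w - w₀) / (1 - w₀) := by field_simp; ring
    rw [e, map_div₀, Valuation.map_neg, h1w₀, div_one]
    exact hd4)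
  refine ⟨z₀ * z₁, ?_⟩
  calc z₀ * z₁ * Θ (z₀ * z₁) = (z₀ * Θ z₀) * (z₁ * Θ z₁) := by rw [map_mul]; ring
    _ = (1 - w₀) * ((1 - w) / (1 - w₀)) := by rw [hz₀, hz₁]
    _ = 1 - w := mul_div_cancel₀ _ h1w₀0

end Summit.HodgeConjecture.HodgeConjecture.Cruxes.H413.F0P3cDyRamTerminalCellDigitFlip

end
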